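import Literature.NumberTheory.LFunctions.KloostermanQuadraticTwist
import HarnessLib

/-!
# Route `PrimeLevelFamEdge` — TYPED IDEA DELTAS, deck 20a (this file = §1) / 20b (§2–§3): lens-18 «complete» × U-d,
# cards K-L18-1 … K-L18-4 (cell ls-idea, seat ls-idea-lens-18; critic E b3 PASS — K-L18-1 as LAW (kernel, folklore);
# LANDING NOTE typer ls-idea-typ-1 gen 2: the seat's `Sketch_Lens18_KloostermanMeanSquare.lean` sha16 2045d251c2eb0480
# §1 VERBATIM up to the namespace (`Literature.NumberTheory.LFunctions.KloostermanMeanSquare` → the deck namespace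
# `.KloostermanMeanSquare`; landed Summits-side as folklore kernel law — a librarian may re-home it under Literature/
# with textbook locators), `import Mathlib` dropped, and §1c = critic E's `uniform_bound_sq_ge` / `sum_kloostermanSum_sq`
# (L18_probe_RefE.lean 3c016f92ca7dd5e5) appended.)
# §1  K-L18-1 «LEMMA 3.3⁺ IS VOID POINTWISE» — the exact mean square of a Kloosterman transform
#     over its FIRST argument at one prime modulus (typing offer «to ls-idea-typ-1», Literature-side,
#     folklore finite-field identities; everything in §1 is PROVED, no `sorry`).
# §2  K-L18-3 «KMS'S OWN NAMED COMPLETION IS A CORNER» — the codimension ladder of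
#     Kowalski–Michel–Sawin 2017 p.11 (`(3l+5)/(4(l+1)) ↓ 3/4`), proved arithmetic.

HONESTY: finite-sum identities and exponent bookkeeping.  Nothing here asserts or proves
`MomentsBeyondDiagonal` (K_A, stmt-Parity-20007), `BeyondDiagonalBeatsQuarter` (K_B), any moment
asymptotic, or any exceptional-zero statement; typed-and-proved here ≠ the door.

§1 in words.  For a prime `p`, `S(a,b;p) = kloostermanSum p a b`.  Additive orthogonality in the first
argument gives the closed form
  `Σ_{a mod p} S(a,n;p) S(a,n′;p) = p(p−1)` if `n = n′`, `= −p` if `n ≠ n′`   (all `n, n′ ∈ ℤ/pℤ`),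
hence for ANY coefficient tables `β, γ : ℤ/pℤ → ℂ`
  `Σ_a (Σ_n β(n)S(a,n;p))(Σ_{n′} γ(n′)S(a,n′;p)) = p² Σ_n β(n)γ(n) − p (Σ β)(Σ γ)`,
and (Kloosterman sums being real) the MEAN SQUARE
  `Σ_a ‖Σ_n β(n) S(a,n;p)‖² = p² Σ_n ‖β(n)‖² − p ‖Σ_n β(n)‖²`.
K-L18-1's reading (pencil, docstring only): in KMV 2000's harmonic second mollified moment at prime
level the `c = q` Petersson term is `(2π/q) Σ_{m ≤ q^{Δ}} a_m T(m) ` with `T(m) = Σ_n b_n S(m,n;q)J₁(…)`,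
`a_m = (x∗x)(m)m^{-1/2}` (Möbius autoconvolution), `b_n = τ(n)n^{-1/2}V(n/q)`; KMV's Lemma 3.3
architecture bounds `T(m)` pointwise in `m` with `|x_m|` outside (Crelle 526 p.13), which for a
mollifier `M = q̂^{Δ}` requires `|T(m)| ≲ q^{1−Δ/2}(log q)^{-3}` for most `m`, whereas the identity forces
`sup_m |T(m)| ≥ RMS ≍ √q (log q)²` — impossible for every `Δ ≥ 1`.  So the programme's literal next lemma
("Lemma 3.3 with `m₁m₂` up to `q^{Δ}`, `Δ > 1`") is void, and any completion must keep the Möbius variables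
inside the `a`-sum (a type-II statement in `m` = barrier note BN-7a's object).
-/

noncomputable section

open Finset

namespace Summit.Parity.GeneralizedHardyLittlewood.Theorems.PrimeLevelFamEdgeIdeaDeltas.KloostermanMeanSquare

open Literature.NumberTheory.LFunctions (kloostermanSum sum_stdAddChar_eq_zero)

variable {p : ℕ} [hp : Fact p.Prime]

/-- Additive orthogonality on `ℤ/pℤ`: `Σ_a e(ab/p) = p·[b = 0]` (Mathlib `AddChar.sum_mulShift` for the
primitive character `ZMod.stdAddChar`). [folklore] -/
theorem sum_stdAddChar_mul_eq (b : ZMod p) :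
    ∑ a : ZMod p, (ZMod.stdAddChar (a * b) : ℂ) = if b = 0 then (p : ℂ) else 0 := by
  classical
  rw [AddChar.sum_mulShift b (ZMod.isPrimitive_stdAddChar p), ZMod.card]
  split_ifs <;> simp

/-- `Σ_{x ∈ (ℤ/pℤ)ˣ} e(c x/p) = p − 1` if `c = 0` and `−1` otherwise (Ramanujan sum to a prime). [folklore] -/
theorem sum_unit_stdAddChar_mul (c : ZMod p) :
    ∑ x : ZMod p, (if IsUnit x then (ZMod.stdAddChar (c * x) : ℂ) else 0) =
      if c = 0 then (p : ℂ) - 1 else -1 := by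
  classical
  have h : ∀ x : ZMod p, (if IsUnit x then (ZMod.stdAddChar (c * x) : ℂ) else 0) =
      ZMod.stdAddChar (x * c) - if x = 0 then (1 : ℂ) else 0 := by
    intro x
    by_cases hx : x = 0
    · subst hx; simp
    · rw [if_pos (isUnit_iff_ne_zero.mpr hx), if_neg hx, sub_zero, mul_comm]
  simp_rw [h]
  rw [Finset.sum_sub_distrib, sum_stdAddChar_mul_eq c, Finset.sum_ite_eq' Finset.univ (0 : ZMod p)]
  simp only [Finset.mem_univ, if_true]
  split_ifs <;> ring

/-- The same sum with `x⁻¹` in place of `x` (reindex by the involution `x ↦ x⁻¹`). [folklore] -/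
theorem sum_unit_stdAddChar_mul_inv (c : ZMod p) :
    ∑ x : ZMod p, (if IsUnit x then (ZMod.stdAddChar (c * x⁻¹) : ℂ) else 0) =
      if c = 0 then (p : ℂ) - 1 else -1 := by
  classical
  rw [← sum_unit_stdAddChar_mul c]
  refine Fintype.sum_equiv (Equiv.inv (ZMod p)) _ _ fun x => ?_
  simp only [Equiv.inv_apply]
  by_cases hx : x = 0
  · subst hx; simp
  · rw [if_pos (isUnit_iff_ne_zero.mpr hx), if_pos (isUnit_iff_ne_zero.mpr (inv_ne_zero hx))]

/-- **Orthogonality of Kloosterman sums in the first argument** at a prime modulus: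
`Σ_{a mod p} S(a,n;p) S(a,n′;p) = p(p−1)` if `n = n′` and `−p` otherwise (expand, sum over `a` first:
only `y = −x` survives, leaving the Ramanujan sum `Σ_{x ≠ 0} e((n−n′)x̄/p)`). [folklore] -/
theorem sum_kloostermanSum_mul_kloostermanSum (n n' : ZMod p) :
    ∑ a : ZMod p, kloostermanSum p a n * kloostermanSum p a n' =
      if n = n' then (p : ℂ) * ((p : ℂ) - 1) else -(p : ℂ) := by
  classical
  -- the `a`-sum of one `(x, y)` term
  have hxy : ∀ x y : ZMod p,
      ∑ a : ZMod p, (if IsUnit x then (ZMod.stdAddChar (a * x + n * x⁻¹) : ℂ) else 0) *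
          (if IsUnit y then (ZMod.stdAddChar (a * y + n' * y⁻¹) : ℂ) else 0) =
        if IsUnit x ∧ IsUnit y then
          (if x + y = 0 then (p : ℂ) else 0) * ZMod.stdAddChar (n * x⁻¹ + n' * y⁻¹) else 0 := by
    intro x y
    by_cases hx : IsUnit x
    · by_cases hy : IsUnit y
      · rw [if_pos ⟨hx, hy⟩]
        have hterm : ∀ a : ZMod p, (if IsUnit x then (ZMod.stdAddChar (a * x + n * x⁻¹) : ℂ) else 0) *
            (if IsUnit y then (ZMod.stdAddChar (a * y + n' * y⁻¹) : ℂ) else 0) =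
            ZMod.stdAddChar (a * (x + y)) * ZMod.stdAddChar (n * x⁻¹ + n' * y⁻¹) := by
          intro a
          rw [if_pos hx, if_pos hy, ← AddChar.map_add_eq_mul, ← AddChar.map_add_eq_mul]
          congr 1; ring
        simp_rw [hterm]
        rw [← Finset.sum_mul, sum_stdAddChar_mul_eq (x + y)]
      · rw [if_neg (fun h => hy h.2)]
        refine Finset.sum_eq_zero fun a _ => ?_
        rw [if_neg hy, mul_zero]
    · rw [if_neg (fun h => hx h.1)]
      refine Finset.sum_eq_zero fun a _ => ?_
      rw [if_neg hx, zero_mul]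
  -- the `y`-sum: only `y = -x` survives
  have hy : ∀ x : ZMod p,
      ∑ y : ZMod p, (if IsUnit x ∧ IsUnit y then
          (if x + y = 0 then (p : ℂ) else 0) * ZMod.stdAddChar (n * x⁻¹ + n' * y⁻¹) else 0) =
        if IsUnit x then (p : ℂ) * ZMod.stdAddChar ((n - n') * x⁻¹) else 0 := by
    intro x
    by_cases hx : IsUnit x
    · rw [if_pos hx, Finset.sum_eq_single (-x)]
      · rw [if_pos ⟨hx, hx.neg⟩, if_pos (add_neg_cancel x)]
        congr 1
        rw [inv_neg]; congr 1; ring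
      · intro y _ hyx
        have hne : x + y ≠ 0 := fun h => hyx (eq_neg_of_add_eq_zero_right h)
        by_cases hu : IsUnit x ∧ IsUnit y
        · rw [if_pos hu, if_neg hne, zero_mul]
        · rw [if_neg hu]
      · intro h; exact absurd (Finset.mem_univ _) h
    · rw [if_neg hx]
      refine Finset.sum_eq_zero fun y _ => ?_
      rw [if_neg (fun h => hx h.1)]
  have h3 : ∀ x : ZMod p,
      (∑ a : ZMod p, ∑ y : ZMod p, (if IsUnit x then (ZMod.stdAddChar (a * x + n * x⁻¹) : ℂ) else 0) *
          (if IsUnit y then (ZMod.stdAddChar (a * y + n' * y⁻¹) : ℂ) else 0)) =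
        if IsUnit x then (p : ℂ) * ZMod.stdAddChar ((n - n') * x⁻¹) else 0 := by
    intro x
    rw [Finset.sum_comm, ← hy x]
    exact Finset.sum_congr rfl fun y _ => hxy x y
  have h4 : ∀ x : ZMod p, (if IsUnit x then (p : ℂ) * ZMod.stdAddChar ((n - n') * x⁻¹) else 0) =
      (p : ℂ) * (if IsUnit x then (ZMod.stdAddChar ((n - n') * x⁻¹) : ℂ) else 0) := by
    intro x; split_ifs <;> simp
  unfold kloostermanSum
  simp_rw [Finset.sum_mul_sum]
  rw [Finset.sum_comm]
  rw [Finset.sum_congr rfl fun x _ => h3 x]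
  simp_rw [h4]
  rw [← Finset.mul_sum, sum_unit_stdAddChar_mul_inv (n - n')]
  by_cases h : n = n'
  · rw [if_pos (sub_eq_zero.mpr h), if_pos h]
  · rw [if_neg (sub_ne_zero.mpr h), if_neg h]; ring

/-- Kloosterman sums are real: `conj S(a,b;p) = S(a,b;p)` (substitute `x ↦ −x`; the tree's
`conj_kloostermanSum_one` is the case `a = 1`). [folklore] -/
theorem conj_kloostermanSum (a b : ZMod p) :
    (starRingEnd ℂ) (kloostermanSum p a b) = kloostermanSum p a b := by
  classical
  unfold kloostermanSum
  rw [map_sum]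
  refine Fintype.sum_equiv (Equiv.neg (ZMod p)) _ _ fun x => ?_
  simp only [Equiv.neg_apply, IsUnit.neg_iff]
  split_ifs with hx
  · rw [← AddChar.map_neg_eq_conj]
    congr 1
    rw [inv_neg]
    ring
  · simp

/-- **Bilinear form of the orthogonality**: for arbitrary tables `β γ : ℤ/pℤ → ℂ`,
`Σ_a (Σ_n β(n)S(a,n;p))(Σ_{n′} γ(n′)S(a,n′;p)) = p² Σ_n β(n)γ(n) − p (Σβ)(Σγ)`. [folklore] -/
theorem sum_transform_mul_transform (β γ : ZMod p → ℂ) :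
    ∑ a : ZMod p, (∑ n : ZMod p, β n * kloostermanSum p a n) *
        (∑ n' : ZMod p, γ n' * kloostermanSum p a n') =
      (p : ℂ) ^ 2 * (∑ n : ZMod p, β n * γ n) -
        (p : ℂ) * (∑ n : ZMod p, β n) * (∑ n : ZMod p, γ n) := by
  classical
  have h1 : ∀ a : ZMod p, (∑ n : ZMod p, β n * kloostermanSum p a n) *
      (∑ n' : ZMod p, γ n' * kloostermanSum p a n') =
      ∑ n : ZMod p, ∑ n' : ZMod p, β n * γ n' * (kloostermanSum p a n * kloostermanSum p a n') := by
    intro a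
    rw [Finset.sum_mul_sum]
    refine Finset.sum_congr rfl fun n _ => Finset.sum_congr rfl fun n' _ => ?_
    ring
  simp_rw [h1]
  rw [Finset.sum_comm]
  have h2 : ∀ n : ZMod p, ∑ a : ZMod p, ∑ n' : ZMod p,
      β n * γ n' * (kloostermanSum p a n * kloostermanSum p a n') =
      ∑ n' : ZMod p, β n * γ n' * (if n = n' then (p : ℂ) * ((p : ℂ) - 1) else -(p : ℂ)) := by
    intro n
    rw [Finset.sum_comm]
    refine Finset.sum_congr rfl fun n' _ => ?_
    rw [← Finset.mul_sum, sum_kloostermanSum_mul_kloostermanSum n n']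
  simp_rw [h2]
  have h3 : ∀ n n' : ZMod p, β n * γ n' * (if n = n' then (p : ℂ) * ((p : ℂ) - 1) else -(p : ℂ)) =
      (if n = n' then (p : ℂ) ^ 2 * (β n * γ n') else 0) - (p : ℂ) * (β n * γ n') := by
    intro n n'
    split_ifs <;> ring
  simp_rw [h3]
  rw [Finset.sum_congr rfl fun n _ => Finset.sum_sub_distrib (s := Finset.univ)
      (f := fun n' => if n = n' then (p : ℂ) ^ 2 * (β n * γ n') else 0)
      (g := fun n' => (p : ℂ) * (β n * γ n'))]
  rw [Finset.sum_sub_distrib]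
  congr 1
  · rw [Finset.mul_sum]
    refine Finset.sum_congr rfl fun n _ => ?_
    rw [Finset.sum_ite_eq Finset.univ n]
    simp
  · rw [mul_assoc, Finset.sum_mul_sum, Finset.mul_sum]
    refine Finset.sum_congr rfl fun n _ => ?_
    rw [Finset.mul_sum]

/-- The Kloosterman transform of a table `β` in the second argument: `T_β(a) = Σ_n β(n) S(a,n;p)`.
[folklore] -/
def transform (β : ZMod p → ℂ) (a : ZMod p) : ℂ := ∑ n : ZMod p, β n * kloostermanSum p a n

/-- `conj T_β(a) = T_{conj β}(a)` (Kloosterman sums are real). [folklore] -/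
theorem conj_transform (β : ZMod p → ℂ) (a : ZMod p) :
    (starRingEnd ℂ) (transform β a) = transform (fun n => (starRingEnd ℂ) (β n)) a := by
  unfold transform
  rw [map_sum]
  refine Finset.sum_congr rfl fun n _ => ?_
  rw [map_mul, conj_kloostermanSum]

/-- **MEAN SQUARE over the first argument** (K-L18-1's law): for every table `β : ℤ/pℤ → ℂ`,
`Σ_{a mod p} ‖Σ_n β(n) S(a,n;p)‖² = p² Σ_n ‖β(n)‖² − p ‖Σ_n β(n)‖²` — square-root cancellation in `a`
on average, EXACTLY, for every coefficient table. [folklore] -/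
theorem meanSquare_transform (β : ZMod p → ℂ) :
    ∑ a : ZMod p, ‖transform β a‖ ^ 2 =
      (p : ℝ) ^ 2 * (∑ n : ZMod p, ‖β n‖ ^ 2) - (p : ℝ) * ‖∑ n : ZMod p, β n‖ ^ 2 := by
  have h := sum_transform_mul_transform (p := p) β (fun n => (starRingEnd ℂ) (β n))
  have hC : ∀ z : ℂ, z * (starRingEnd ℂ) z = ((‖z‖ ^ 2 : ℝ) : ℂ) := by
    intro z; rw [Complex.mul_conj, Complex.normSq_eq_norm_sq]
  have hL : ∀ a : ZMod p, (∑ n : ZMod p, β n * kloostermanSum p a n) *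
      (∑ n' : ZMod p, (starRingEnd ℂ) (β n') * kloostermanSum p a n') = ((‖transform β a‖ ^ 2 : ℝ) : ℂ) := by
    intro a
    rw [← hC (transform β a), conj_transform]
    rfl
  simp_rw [hL, hC] at h
  rw [← map_sum, mul_assoc, hC] at h
  exact_mod_cast h

/-- **Corollary (sup ≥ mean)**: some residue `a` carries at least the average,
`∃ a, p·‖T_β(a)‖² ≥ p² Σ‖β‖² − p‖Σβ‖²` — so NO bound `‖T_β(a)‖ ≤ B` valid for all `a` can have
`B² < p Σ‖β‖² − ‖Σβ‖²`; this is the rigorous core of «Lemma 3.3⁺ is void pointwise». [folklore] -/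
theorem exists_norm_transform_sq_ge (β : ZMod p → ℂ) :
    ∃ a : ZMod p, (p : ℝ) ^ 2 * (∑ n : ZMod p, ‖β n‖ ^ 2) - (p : ℝ) * ‖∑ n : ZMod p, β n‖ ^ 2 ≤
      (p : ℝ) * ‖transform β a‖ ^ 2 := by
  classical
  by_contra hcon
  push Not at hcon
  have hlt : ∑ a : ZMod p, (p : ℝ) * ‖transform β a‖ ^ 2 <
      ∑ _a : ZMod p, ((p : ℝ) ^ 2 * (∑ n : ZMod p, ‖β n‖ ^ 2) - (p : ℝ) * ‖∑ n : ZMod p, β n‖ ^ 2) :=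
    Finset.sum_lt_sum_of_nonempty Finset.univ_nonempty fun a _ => hcon a
  rw [Finset.sum_const, Finset.card_univ, ZMod.card, ← Finset.mul_sum, meanSquare_transform,
    nsmul_eq_mul] at hlt
  exact lt_irrefl _ hlt

/-! ### §1c Critic E's corollaries (REF-E b3) -/

/-- Critic E (REF-E b3, `L18_probe_RefE.lean` sha16 3c016f92ca7dd5e5, evidence #32; K-L18-1, the kernel core of «Lemma 3.3⁺ is void»): a first-entry bound `‖T_β(a)‖ ≤ B`
that is UNIFORM in `a` forces `p·Σ‖β‖² − ‖Σβ‖² ≤ B²` (so `B ≳ RMS`); a-DEPENDENT pointwise bounds are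
not covered by this (they need the ℓ¹ count, pencil). -/
theorem uniform_bound_sq_ge (β : ZMod p → ℂ) (B : ℝ) (hB : ∀ a : ZMod p, ‖transform β a‖ ≤ B) :
    (p : ℝ) * (∑ n : ZMod p, ‖β n‖ ^ 2) - ‖∑ n : ZMod p, β n‖ ^ 2 ≤ B ^ 2 := by
  obtain ⟨a, ha⟩ := exists_norm_transform_sq_ge (p := p) β
  have hp0 : (0 : ℝ) < p := by exact_mod_cast hp.out.pos
  have h1 : ‖transform β a‖ ^ 2 ≤ B ^ 2 :=
    pow_le_pow_left₀ (norm_nonneg _) (hB a) 2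
  have h2 : (p : ℝ) * ((p : ℝ) * (∑ n : ZMod p, ‖β n‖ ^ 2) - ‖∑ n : ZMod p, β n‖ ^ 2) ≤
      (p : ℝ) * B ^ 2 := by
    nlinarith [ha, h1, hp0.le, mul_le_mul_of_nonneg_left h1 hp0.le]
  exact le_of_mul_le_mul_left h2 hp0

/-- Critic E (REF-E b3; K-L18-1, special case = the classical `Σ_a S(a,n;p)² = p(p−1)`, i.e.
`Σ_{a ≠ 0} S(a,1;p)² = p² − p − 1` once the Ramanujan term `a = 0` is split off). -/
theorem sum_kloostermanSum_sq (n : ZMod p) :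
    ∑ a : ZMod p, kloostermanSum p a n * kloostermanSum p a n = (p : ℂ) * ((p : ℂ) - 1) := by
  rw [sum_kloostermanSum_mul_kloostermanSum, if_pos rfl]


/-! ### §1d The exact affine autocorrelation identity of an additive table (A-L18-1; seat ls-idea-lens-18 Sketch v2
sha16 9dfcf193e3f52d4f §4, critic E: kernel upgrade, no re-mark needed; LANDED VERBATIM by typer ls-idea-typ-1 gen 3 up to
the namespace and the `[folklore]` tags moved into prose).  For any table `b : ℤ/pℤ → ℂ` with additive transform
`E_b(y) := Σ_k b(k) e(ky/p)` and any `λ, μ ∈ ℤ/pℤ`,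
  `Σ_y E_b(y) · conj(E_b(λy + μ)) = p · Σ_k b(λk) · conj(b(k)) · e(−kμ/p)`   (folklore, PROVED).
Seat's reading (pencil, docstring only): for the divisor table `b(k) = Σ_{n ≡ k} τ(n)n^{-1/2}V(n/q)` and small-height
`λ`, the right side is an ALIGNED divisor sum of the size of the diagonal (measured 0.58–0.64 of `p‖b‖²` at
`λ = 1, μ = 1`, `p ≤ 16001`): additive shifts do not decorrelate a table whose mass is log-uniform in `k` — with the
Estermann functional equation this is the mechanism behind the (numerical) death of deck 20b's conjecture shape
`AffineEstermannDecorrelation`.  Computed ≠ proved; the identity below is the only kernel content. -/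

section AffineAutocorrelation

/-- The additive transform `E_b(y) = Σ_k b(k) e(ky/p)` of a table on `ℤ/pℤ`. (folklore) -/
def addTransform (b : ZMod p → ℂ) (y : ZMod p) : ℂ :=
  ∑ k : ZMod p, b k * (ZMod.stdAddChar (k * y) : ℂ)

/-- Complex conjugate of the additive transform, character by character (folklore). -/
theorem conj_addTransform (b : ZMod p → ℂ) (y : ZMod p) :
    (starRingEnd ℂ) (addTransform b y) =
      ∑ k : ZMod p, (starRingEnd ℂ) (b k) * (ZMod.stdAddChar (-(k * y)) : ℂ) := by
  unfold addTransform
  rw [map_sum]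
  refine Finset.sum_congr rfl fun k _ => ?_
  rw [map_mul, ← AddChar.map_neg_eq_conj]

/-- **Exact affine autocorrelation**: `Σ_y E_b(y)·conj E_b(λy+μ) = p·Σ_k b(λk)·conj b(k)·e(−kμ/p)`.
(folklore) -/
theorem sum_addTransform_mul_conj_affine (b : ZMod p → ℂ) (l m : ZMod p) :
    ∑ y : ZMod p, addTransform b y * (starRingEnd ℂ) (addTransform b (l * y + m)) =
      (p : ℂ) * ∑ k : ZMod p,
        b (l * k) * (starRingEnd ℂ) (b k) * (ZMod.stdAddChar (-(k * m)) : ℂ) := by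
  classical
  simp_rw [conj_addTransform]
  have h1 : ∀ y : ZMod p,
      addTransform b y * ∑ k : ZMod p, (starRingEnd ℂ) (b k) * (ZMod.stdAddChar (-(k * (l * y + m))) : ℂ) =
        ∑ k : ZMod p, ∑ j : ZMod p, b j * (starRingEnd ℂ) (b k) * (ZMod.stdAddChar (-(k * m)) : ℂ) *
          (ZMod.stdAddChar (y * (j - l * k)) : ℂ) := by
    intro y
    unfold addTransform
    rw [Finset.sum_mul_sum, Finset.sum_comm]
    refine Finset.sum_congr rfl fun k _ => Finset.sum_congr rfl fun j _ => ?_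
    have hψ : (ZMod.stdAddChar (j * y) : ℂ) * ZMod.stdAddChar (-(k * (l * y + m))) =
        (ZMod.stdAddChar (-(k * m)) : ℂ) * ZMod.stdAddChar (y * (j - l * k)) := by
      rw [← AddChar.map_add_eq_mul, ← AddChar.map_add_eq_mul]
      congr 1
      ring
    calc b j * (ZMod.stdAddChar (j * y) : ℂ) *
          ((starRingEnd ℂ) (b k) * (ZMod.stdAddChar (-(k * (l * y + m))) : ℂ))
        = b j * (starRingEnd ℂ) (b k) *
            ((ZMod.stdAddChar (j * y) : ℂ) * ZMod.stdAddChar (-(k * (l * y + m)))) := by ring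
      _ = b j * (starRingEnd ℂ) (b k) *
            ((ZMod.stdAddChar (-(k * m)) : ℂ) * ZMod.stdAddChar (y * (j - l * k))) := by rw [hψ]
      _ = _ := by ring
  simp_rw [h1]
  rw [Finset.sum_comm, Finset.mul_sum]
  refine Finset.sum_congr rfl fun k _ => ?_
  rw [Finset.sum_comm]
  have h2 : ∀ j : ZMod p,
      ∑ y : ZMod p, b j * (starRingEnd ℂ) (b k) * (ZMod.stdAddChar (-(k * m)) : ℂ) *
          (ZMod.stdAddChar (y * (j - l * k)) : ℂ) =
        b j * (starRingEnd ℂ) (b k) * (ZMod.stdAddChar (-(k * m)) : ℂ) *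
          (if j - l * k = 0 then (p : ℂ) else 0) := by
    intro j
    rw [← Finset.mul_sum, sum_stdAddChar_mul_eq]
  simp_rw [h2]
  have h3 : ∀ j : ZMod p,
      b j * (starRingEnd ℂ) (b k) * (ZMod.stdAddChar (-(k * m)) : ℂ) *
          (if j - l * k = 0 then (p : ℂ) else 0) =
        if j = l * k then (p : ℂ) * (b j * (starRingEnd ℂ) (b k) * (ZMod.stdAddChar (-(k * m)) : ℂ))
        else 0 := by
    intro j
    by_cases hj : j = l * k
    · rw [if_pos (sub_eq_zero.mpr hj), if_pos hj]
      ring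
    · rw [if_neg (sub_ne_zero.mpr hj), if_neg hj, mul_zero]
  simp_rw [h3]
  rw [Finset.sum_ite_eq' Finset.univ (l * k)]
  simp

/-- The shift case `λ = 1`: `Σ_y E_b(y)·conj E_b(y+μ) = p·Σ_k ‖b(k)‖²·e(−kμ/p)` — the additive autocorrelation
of `E_b` is `p` times the Fourier transform of the mass profile `k ↦ ‖b(k)‖²`. (folklore) -/
theorem sum_addTransform_mul_conj_shift (b : ZMod p → ℂ) (m : ZMod p) :
    ∑ y : ZMod p, addTransform b y * (starRingEnd ℂ) (addTransform b (y + m)) =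
      (p : ℂ) * ∑ k : ZMod p, (‖b k‖ ^ 2 : ℂ) * (ZMod.stdAddChar (-(k * m)) : ℂ) := by
  have h := sum_addTransform_mul_conj_affine b 1 m
  simp only [one_mul] at h
  rw [h]
  congr 1
  refine Finset.sum_congr rfl fun k _ => ?_
  rw [Complex.mul_conj, Complex.normSq_eq_norm_sq]
  push_cast
  ring

/-- At `μ = 0` (and `λ = 1`) this is Parseval: `Σ_y ‖E_b(y)‖² = p·Σ_k ‖b(k)‖²`. (folklore) -/
theorem sum_norm_addTransform_sq (b : ZMod p → ℂ) :
    ∑ y : ZMod p, (‖addTransform b y‖ ^ 2 : ℂ) = (p : ℂ) * ∑ k : ZMod p, (‖b k‖ ^ 2 : ℂ) := by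
  have h := sum_addTransform_mul_conj_shift b 0
  simp only [add_zero, mul_zero, neg_zero, AddChar.map_zero_eq_one, mul_one] at h
  rw [← h]
  refine Finset.sum_congr rfl fun y _ => ?_
  rw [Complex.mul_conj, Complex.normSq_eq_norm_sq]
  push_cast
  ring

end AffineAutocorrelation

end Summit.Parity.GeneralizedHardyLittlewood.Theorems.PrimeLevelFamEdgeIdeaDeltas.KloostermanMeanSquare

end
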